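import Summits.CriticalPhenomena.PercolationContinuityZ3.Theses.PercBurnResprinkle
import Literature.Probability.Percolation.PercolationProofs
import Literature.Probability.Percolation.ConstrainedClusters

/-!
# Line `hole-hug-dichotomy` for crux `PercBurnResprinkle.JumpFireBreak` (stmt-CriticalPhenomena-7204)

crux-plan (planner-cruxplan-stmt-CriticalPhenomena-7204-hole-hug-dichotomy-0, 2026-08-16), from idea card
`Cruxes/JumpFireBreak/Ideas/hole-hug-dichotomy.md` AS SHARPENED BY THE TRIAGE PANEL (r1-1 fail, r1-2 pass, r1-3 pass)
and by `Cruxes/JumpFireBreak/Disproof.lean` §7(e),(h).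

## What survives of the card, and what was dropped

The card's DICHOTOMY survives: a would-be infinite vacant `(p_c+ε)`-cluster either travels through the HOLES of
`I = I_{p_c}` (regions at distance `> R` from `I`) or HUGS `I`.  Its PRICING LEVER does not: Grimmett–Marstrand
blocks at the legal level `p_c+ε` plus the sprinkle budget constrain nothing — open `J–I` contacts are implied by
block goodness but are free for `J`, `J`'s adjacency budget is a size-blind density (AmenableInvariantPercolation),
and the exponent bookkeeping needs `a < 2/3` against `a ≥ 2/3` (Disproof §7(h); TRIAGE r1-1/2/3).  Both branches are
therefore re-priced at the level of PIVOTAL MASS of the fresh field, where the dichotomy is exactly the defect term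
of an Aizenman–Grimmett essential-DIMINISHMENT inequality (the route's foreseen engine, Disproof §7(e)'s split
`AGWithSparseDefects → JumpSparseness → JumpFireBreak`, cut finer here):

* (B, hugging) pivotal edges of the finite-volume connection `0 ↔ ∂Λ_n` lying within distance `R` of a burnt site are
  converted into deletion-pivotal burnt SITES by local surgery with constants uniform in the environment
  (`stub_hugSurgery`, printed AG surgery; never needs `R`-density, cf. Disproof §4);
* (A, holes) pivotal edges deep in holes are the defect term; `stub_shareFromSparseness` says they are at most a
  `(1-δ)`-fraction of the pivotal mass, uniformly, near deletion density `s = 0`, GIVEN light tails of the clean cells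
  of `I` (`stub_jumpSparseness` = Disproof §7 HANDLE 2 `JumpSparseness`, the open jump-world input; uses `θ(p_c) > 0`);
* glue (`stub_agSegment`): Russo in both parameters of the family "fresh field at level `p`, each burnt site deleted
  independently with probability `s`" + the AG line-segment argument started at a SUBCRITICAL point `(p_c − η, 0)`
  (so `θ(p_c) > 0` is never in the way) give an a.s. fire-break for the `s`-THINNED burnt set for some small `s > 0`;
  deleting all of `I` only shrinks the vacant graph, so the crux follows by monotonicity (proved in `JumpFireBreak_of`).

KEY REMARK (why near `s = 0` suffices and why the defect term is harmless there): at `s = 0` nothing is deleted, the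
fresh field is independent of `I`, and the near-`I` share of the pivotal mass is EXACTLY `P(B_R(e) ∩ I ∩ Λ_n ≠ ∅) ≥ θ(p_c)`;
the content of `stub_shareFromSparseness` is the uniformity of that share for `s ∈ (0, a]` (perturbative regime), and
`p_c(ℤ³∖D_s) > p_c` for ONE small `s` already gives `p_c(ℤ³∖I) ≥ p_c(ℤ³∖D_s) > p_c`.

Disproof.lean honoured: `jumpFireBreak_false_without_jump` — the jump is used at `stub_jumpSparseness` (only there);
`jumpFireBreak_false_without_geometry` / `cleanCells_infinite_planes` — the i.i.d. planes have infinite clean cells,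
so they fail the hypothesis of `stub_shareFromSparseness` (and must: surgery + segment would otherwise make them a
fire-break, contradicting `planes_not_fireBreak`); `ae_not_boxDense_criticalBurnt` — no `R`-density is assumed anywhere,
the hole branch is carried as a defect term; §7(h) — branch (B)'s exponent arithmetic is gone.

All notions are inlined over tree vocabulary (`labelMeasure`, `configOfLabels`, `openCluster`, `openClusterIn`,
`withinGraph`, `box`, `zdGraph`, `theta`, `criticalProb`, `criticalProbI`); the clean-cell vocabulary is Disproof.lean §7's
(`RClean` as the set `cleanVerts`; same bodies otherwise), so `stub_jumpSparseness` is `Disproof.JumpSparseness` up to unfolding.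
-/

noncomputable section

open MeasureTheory ProbabilityTheory
open Literature.Probability.Percolation Literature.Probability.LatticeModels

namespace Summit.CriticalPhenomena.PercolationContinuityZ3.Cruxes.JumpFireBreak.HoleHugDichotomy

attribute [local instance] isProbabilityMeasure_labelMeasure

/-! ## §0 Vocabulary -/

/-- Vertices of `ℤ³`. -/
abbrev V3 : Type := Fin 3 → ℤ

/-- The cubic lattice. -/
abbrev G3 : SimpleGraph V3 := zdGraph 3

/-- A label field (i.i.d. uniform `[0,1]` under `μ`): one real per unordered pair; edges `s(x,y)` carry bond labels,
the DIAGONAL pairs `s(y,y)` (not edges of `G3`) are used as site coins. -/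
abbrev Labels : Type := Sym2 V3 → ℝ

/-- `p_c(ℤ³)`. -/
abbrev pc : ℝ := criticalProb G3 (0 : V3)

/-- i.i.d. uniform labels. -/
abbrev μ : Measure Labels := labelMeasure V3

/-- Environment labels `U` ⊗ fresh labels `U'` ⊗ deletion coins `W`: `π = ((U, U'), W)`. -/
def μ3 : Measure ((Labels × Labels) × Labels) := (μ.prod μ).prod μ

/-- The burnt set `I(U) = I_{p_c}(U) = {y : C_{ω_{p_c}(U)}(y) is infinite}`. -/
def burnt (U : Labels) : Set V3 := {y | (openCluster (configOfLabels pc U G3) y).Infinite}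

/-- The `s`-THINNED burnt set `D_s(U, W) = {y ∈ I(U) : W_y ≤ s}` (each burnt site deleted independently with
probability `s`; `s = 1` deletes all of `I` a.s., `s = 0` nothing a.s.). -/
def deleted (s : ℝ) (U W : Labels) : Set V3 := {y | y ∈ burnt U ∧ W s(y, y) ≤ s}

/-- The vacant fresh configuration off a deleted set `D` at field level `q`. -/
def vacant (D : Set V3) (q : ℝ) (U' : Labels) : BondConfig V3 :=
  {e | e ∈ configOfLabels q U' G3 ∧ ∀ y ∈ e, y ∉ D}

/-- The finite-volume connection EVENT `0 ↔ ∂Λ_n`: `ω`-open steps inside `Λ_n = box 3 n` avoiding the deleted set `D`. -/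
def ConnN (n : ℕ) (D : Set V3) : Set (BondConfig V3) :=
  {ω | ∃ y : V3, (∃ i, |y i| = (n : ℤ)) ∧
    y ∈ openClusterIn (withinGraph G3 (((box 3 n : Finset V3) : Set V3) ∩ Dᶜ)) ω 0}

/-- The event "`e` is pivotal (for the fresh field) for `0 ↔ ∂Λ_n` off `D`". -/
def EdgePivotal (n : ℕ) (D : Set V3) (e : Sym2 V3) : Set (BondConfig V3) :=
  {ω | insert e ω ∈ ConnN n D ∧ ω \ {e} ∉ ConnN n D}

/-- The event "the site `y` is deletion-pivotal for `0 ↔ ∂Λ_n`": retained it connects, deleted it does not. -/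
def SitePivotal (n : ℕ) (D : Set V3) (y : V3) : Set (BondConfig V3) :=
  {ω | ω ∈ ConnN n (D \ {y}) ∧ ω ∉ ConnN n (insert y D)}

/-- The environments in which `e` has a burnt site inside `Λ_n` within sup-distance `R` of one of its endpoints
(the hugging case). -/
def NearBurnt (R n : ℕ) (e : Sym2 V3) : Set Labels :=
  {U | ∃ y ∈ burnt U, y ∈ (box 3 n : Finset V3) ∧ ∃ z ∈ e, y - z ∈ (box 3 R : Finset V3)}

/-- Expected number of pivotal edges at parameters `(p, s)` (`= ∂θ_n/∂p`, Russo). -/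
def pivE (n : ℕ) (p s : ℝ) : ℝ :=
  ∑' e : Sym2 V3, (μ3).real {π | configOfLabels p π.1.2 G3 ∈ EdgePivotal n (deleted s π.1.1 π.2) e}

/-- Expected number of pivotal edges HUGGING the burnt set (within `R`). -/
def pivNear (n : ℕ) (p s : ℝ) (R : ℕ) : ℝ :=
  ∑' e : Sym2 V3, (μ3).real {π | configOfLabels p π.1.2 G3 ∈ EdgePivotal n (deleted s π.1.1 π.2) e ∧
    π.1.1 ∈ NearBurnt R n e}

/-- Expected number of deletion-pivotal burnt sites (`= -∂θ_n/∂s`, Russo). -/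
def pivS (n : ℕ) (p s : ℝ) : ℝ :=
  ∑' y : V3, (μ3).real {π | y ∈ burnt π.1.1 ∧ configOfLabels p π.1.2 G3 ∈ SitePivotal n (deleted s π.1.1 π.2) y}

/-- Branch (A) killed: on the parameter window `[p_c−a, p_c+a] × [0, a]` the hugging pivotal mass is at least a
`δ`-fraction of the whole, uniformly in the volume. -/
def Share (R : ℕ) (a δ : ℝ) : Prop :=
  ∀ (n : ℕ) (p s : ℝ), pc - a ≤ p → p ≤ pc + a → 0 ≤ s → s ≤ a → δ * pivE n p s ≤ pivNear n p s R

/-- Branch (B) priced: hugging pivotal edges convert into deletion-pivotal burnt sites (AG surgery inequality). -/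
def SurgeryIneq (R : ℕ) (a c : ℝ) : Prop :=
  ∀ (n : ℕ) (p s : ℝ), pc - a ≤ p → p ≤ pc + a → 0 ≤ s → s ≤ a → c * pivNear n p s R ≤ pivS n p s

/-- Fire-break for the `s`-thinned burnt set at field level `p_c + ε`: a.s. no vertex percolates. -/
def ThinnedFireBreak (s ε : ℝ) : Prop :=
  μ3 {π | ∃ x : V3, (openCluster (vacant (deleted s π.1.1 π.2) (pc + ε) π.1.2) x).Infinite} = 0

/-- The `R`-clean vertices for `D`: those whose `R`-box misses `D` (Disproof.lean §7 `RClean`, as a set). -/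
def cleanVerts (R : ℕ) (D : Set V3) : Set V3 := {x | ∀ y ∈ D, y - x ∉ (box 3 R : Finset V3)}

/-- The `R`-clean cell of `x`: its component in the lattice restricted to `R`-clean vertices (Disproof.lean §7). -/
def cleanCell (R : ℕ) (D : Set V3) (x : V3) : Set V3 := {y | (withinGraph G3 (cleanVerts R D)).Reachable x y}

/-- HANDLE 2 of Disproof.lean §7 for `I_{p_c}`: stretched-exponential (surface-order) tail of the clean cell of the
origin, infinite cells included in the tail event. -/
def CleanCellsExpTail (R : ℕ) : Prop :=
  ∃ c C : ℝ, 0 < c ∧ ∀ n : ℕ,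
    μ.real {U | (cleanCell R (burnt U) 0).Infinite ∨ n ≤ (cleanCell R (burnt U) 0).ncard}
      ≤ C * Real.exp (-c * (n : ℝ) ^ ((2 : ℝ) / 3))

/-! ## §1 The stubs -/

/-- **stub_jumpSparseness** (branch (A) input; = `Disproof.JumpSparseness`, the open jump-world statement; the
ONLY place the jump hypothesis is used).  In a jump world the holes of the critical infinite cluster are sparse:
for some `R`, the `R`-clean cell of the origin has a stretched-exponential volume tail (in particular all clean
cells are finite a.s.).  Why plausible: a jump means `I_{p_c}` has density `θ(p_c) > 0` and is the a.s. unique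
infinite cluster; scale-invariant holes at `p_c` are the signature of a CONTINUOUS transition; the sealed-chamber
lower bound `e^{-cL²}` (finite energy) is exactly surface order, so the exponent `2/3` is the strongest possible.
Why it might fail: nothing derives hole sparseness from `θ(p_c) > 0` (SprinklingRenormalisation: no same-`p` block
step at `p_c`); the Aizenman–Newman `1/r²` jump world has fat debris.  Size: open problem (hardest stub). -/
theorem stub_jumpSparseness :
    0 < theta (zdGraph 3) (0 : Fin 3 → ℤ) (criticalProbI 3) → ∃ R : ℕ, CleanCellsExpTail R := by
  sorry

/-- **stub_shareFromSparseness** (branch (A) killed: holes do not carry the pivotal mass).  Given light-tailed clean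
cells of `I`, there is a parameter window `[p_c−a, p_c+a] × [0,a]` on which, for every volume `n`, at least a
`δ`-fraction of the expected number of pivotal edges of `0 ↔ ∂Λ_n` (fresh level `p`, `s`-thinned deletion) lies
within distance `R` of a burnt site.  Why plausible: at `s = 0` it is an IDENTITY with `δ = θ(p_c)` (fresh field
independent of `I`, nothing deleted); for `s ∈ (0,a]` the deleted set is a sparse perturbation, and escaping into a
hole of volume `m` costs `e^{-c m^{2/3}}` (hypothesis) against a gain `e^{O(s·m)}` in connectivity, so holes of
volume `≲ s⁻³` are not worth entering and the collar fraction stays `≳ R s³ ∧ θ(p_c)`.  Why it might fail: uniformity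
in `n` through the near-critical window is a large-deviation statement about where near-critical pivotal edges sit
in a sparsely perforated lattice — unwritten; i.i.d. planes (infinite clean slabs) show the hypothesis cannot be
dropped.  Size: L (open; the line's own bet). -/
theorem stub_shareFromSparseness :
    (∃ R : ℕ, CleanCellsExpTail R) →
      ∃ (R : ℕ) (a δ : ℝ), 0 < a ∧ a < pc ∧ pc + a < 1 ∧ 0 < δ ∧ Share R a δ := by
  sorry

/-- **stub_hugSurgery** (branch (B) priced: Aizenman–Grimmett local surgery for a DIMINISHMENT, constants uniform in
the environment).  For `p ∈ [p_c−a, p_c+a] ⊂ (0,1)` and `s ∈ [0,a]`: `c · pivNear ≤ pivS`.  Why true: given a pivotal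
edge `e` and a burnt site `y ∈ Λ_n` within `R` of it, modify the fresh labels in the window `B_{R+2}(e) ∩ Λ_n` (close
everything except one path first-entry `a` → `y` → last-exit `b` through the relative interior of the window) and set
the coins of the burnt vertices ON THAT PATH to "retained" (cost factor `≤ (1−a)^{-|window|}`, never `1/s`; boundary
vertices of the window keep their status); then every allowed `0 ↔ ∂Λ_n` path enters the window (else it existed
before and avoided `e`), can enter only at `a` or `b`, hence passes `y`: `y` is deletion-pivotal.
The map is `K(R)`-to-one and distorts probability by `≤ m^{-|E(window)|}(1−a)^{-|window|}`, `m = min(p_c−a, 1−p_c−a)`.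
Leans on: `BlockResampling.map_resample_prod`, `bond_real_mem_dataEvent_eq` (resampling kit), `AGLine.gW_le_of_modification`
(the same weight comparison, abstract).  Size: L (printed argument: Grimmett 1999 Thm (3.16) pp. 65–67;
Aizenman–Grimmett 1991; Balister–Bollobás–Riordan arXiv:1402.0834 for the repaired hypotheses). -/
theorem stub_hugSurgery :
    ∀ (R : ℕ) (a : ℝ), 0 < a → a < pc → pc + a < 1 → ∃ c : ℝ, 0 < c ∧ SurgeryIneq R a c := by
  sorry

/-- **stub_agSegment** (glue: the AG differential inequality near deletion density `0` and the line-segment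
argument).  `θ_n(p,s) := μ3(ConnN n (D_s) (ω'_p))` is, for each `n`, a finite mixture of polynomials in `(p,s)` with
`∂_p θ_n = pivE`, `∂_s θ_n = −pivS` (Russo in the fresh labels and in the coins); Share and SurgeryIneq give
`∂_p θ_n + κ ∂_s θ_n ≤ 0` on the window with `κ = 1/(cδ)`, so `λ ↦ θ_n(p_c − η + λ, κλ)` is non-increasing while it
stays in the window; `θ_n(p_c−η, 0) → θ(p_c−η) = 0` (subcritical, every world) and `θ_n ↓ μ3(0 percolates off D_s)`
(König), whence `μ3(0 percolates off D_s at level p_c+ε) = 0` with `s = κλ`, `ε = λ/2`; shift-covariance of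
`(I, D_s, vacant)` and invariance of `μ3` upgrade "the origin" to "every vertex".  Leans on: `AGLine.theta_line_mono`
/ `hasDerivAt_theta_line` (pattern), `DeterminedBy`, `continuous_bondPercolation_real_of_determinedBy`,
`theta_eq_zero_of_lt_criticalProb_holds`, Disproof §2/§6 covariance kit (pattern).  Size: M–L (all standard). -/
theorem stub_agSegment :
    ∀ (R : ℕ) (a δ c : ℝ), 0 < a → a < pc → pc + a < 1 → 0 < δ → 0 < c →
      Share R a δ → SurgeryIneq R a c → ∃ s ε : ℝ, 0 < s ∧ s ≤ 1 ∧ 0 < ε ∧ ThinnedFireBreak s ε := by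
  sorry

/-! ## §2 The composition (kernel-checked; no `sorry` of its own) -/

/-- **`JumpFireBreak_of`**: the four stubs give the crux BY NAME.  The only mathematics here is the thinning
monotonicity `D_s ⊆ I ⇒ (vacant off I) ⊆ (vacant off D_s)` and the marginalisation of the coins. -/
theorem JumpFireBreak_of : Theses.PercBurnResprinkle.JumpFireBreak := by
  intro hjump
  obtain ⟨R₀, hR₀⟩ := stub_jumpSparseness hjump
  obtain ⟨R, a, δ, ha, hapc, hpca, hδ, hshare⟩ := stub_shareFromSparseness ⟨R₀, hR₀⟩
  obtain ⟨c, hc, hsurg⟩ := stub_hugSurgery R a ha hapc hpca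
  obtain ⟨s, ε, _hs0, _hs1, hε, hnull⟩ := stub_agSegment R a δ c ha hapc hpca hδ hc hshare hsurg
  refine ⟨ε, hε, ?_⟩
  -- the crux's null set `A` (environment `π.1`, fresh field `π.2`)
  set A : Set (Labels × Labels) := {π | ∃ x : V3, (openCluster {e | e ∈ configOfLabels (pc + ε) π.2 G3 ∧
      ∀ y ∈ e, ¬ (openCluster (configOfLabels pc π.1 G3) y).Infinite} x).Infinite} with hA
  -- thinning monotonicity: `A × (all coins) ⊆` the thinned percolation event
  have hsub : A ×ˢ (Set.univ : Set Labels) ⊆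
      {π : (Labels × Labels) × Labels |
        ∃ x : V3, (openCluster (vacant (deleted s π.1.1 π.2) (pc + ε) π.1.2) x).Infinite} := by
    rintro ⟨⟨U, U'⟩, W⟩ hπ
    obtain ⟨⟨x, hx⟩, -⟩ := hπ
    refine ⟨x, hx.mono (openCluster_mono ?_ x)⟩
    intro e he
    refine ⟨he.1, fun y hy hdel => ?_⟩
    obtain ⟨hburnt, -⟩ := hdel
    exact he.2 y hy hburnt
  have h3 : μ3 (A ×ˢ (Set.univ : Set Labels)) = 0 := measure_mono_null hsub hnull
  have hprod : μ3 (A ×ˢ (Set.univ : Set Labels)) = (μ.prod μ) A * μ Set.univ := by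
    unfold μ3
    exact Measure.prod_prod A Set.univ
  rw [hprod, measure_univ, mul_one] at h3
  simpa [hA] using h3

end Summit.CriticalPhenomena.PercolationContinuityZ3.Cruxes.JumpFireBreak.HoleHugDichotomy

end
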